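import Literature.AlgebraicGeometry.Motives.ProjectiveNoetherNormalization
import Literature.AlgebraicGeometry.Motives.AbelianVarietyProjectiveChart
import Literature.AlgebraicGeometry.Morphisms.CechH1ProjectiveFinite
import HarnessLib

/-!
# A projective variety of dimension `d` has an affine open cover with `d + 1` members (via Noether normalisation)

Topic `Literature/AlgebraicGeometry/ProjectiveGeometry`; namespace `Literature.AlgebraicGeometry.ProjectiveGeometry`.  THEOREMS ONLY (no
definition, no instance, no notation, no named fact, no `sorry`).  Cell `hodgecm-mathlib` (D-0151), P6 «MOD programme», DUAL-S road (A), brick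
**B6-COVER** of B-p04 (g40)'s cut «H1-DIM-ANY-CHAR» (memo `MEMO-H1DIM-cut.v1` §2 B6): the Grothendieck ∕ Čech complex of an abelian variety of
dimension `g` computed on an affine cover with `g + 1` members has amplitude `[0, g]`, which is what the duality-free proof of
`dim Ȟ¹(A, 𝒪_A) = g` ([MumfordAV1970] §13) consumes.  HC_CM is proved only modulo the printed citations until rung 0 closes; nothing here is
about HC.

THE MATHEMATICS ([Hartshorne1977] III Ex. 4.8 (road: `X` projective of dimension `d` is covered by `d + 1` open affines) and II Ex. 3.22 ∕
Thm. I.7.2 behind it; [GortzWedhorn2020] Thm. 13.89 (projective Noether normalisation)).  The classical proof cuts `X ⊆ ℙⁿ` by `d + 1`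
hypersurfaces with empty common intersection.  Here we read it off PROJECTIVE NOETHER NORMALISATION, which the tree proves over an ARBITRARY
field (★ `CartierDivisor.IsAmple.exists_finite_surjective_linEquiv`, by forms of high degree, so no «`k` infinite»): an integral proper
`K`-scheme `X` with an ample Cartier divisor admits a FINITE surjective `K`-morphism `ψ : X → ℙ^d_K`, `d = dim X`.  A finite morphism is
affine, so the `d + 1` standard charts `D₊(xᵢ)` of `ℙ^d_K` pull back to AFFINE opens `ψ⁻¹D₊(xᵢ)` of `X` (★ `ProjCech.isAffineOpen_cover`),
and they cover `X` because the `D₊(xᵢ)` cover `ℙ^d` (★ `ProjCech.iSup_cover_eq_top`).  An abelian variety over any field is integral,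
proper and carries an ample divisor (★ `AbelianVariety.exists_isAmple_symmetric_holds`), whence the cover with `dim A + 1` members (§2).

MAIN STATEMENTS.  §1 **`exists_affineCover_fin_schemeDim_succ`** `(hamp : ∃ D : CartierDivisor X, D.IsAmple) :
∃ U : Fin (schemeDim X + 1) → X.affineOpens, (⨆ i, (U i).1) = ⊤` for `X` integral and proper over a field `K`;
§2 **`AbelianVariety.exists_affineCover_fin_dim_succ`** `(A : AbelianVariety k) : ∃ U : Fin (A.dim + 1) → A.X.left.affineOpens, (⨆ i, (U i).1) = ⊤`,
and the unbundled form `AbelianVariety.exists_affineCover_fin_dim_succ'` (`U : Fin (A.dim + 1) → A.X.left.Opens` with `IsAffineOpen (U i)` and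
`iSup U = ⊤` — the binder shape of ★ `finrank_cechH1_structureSheaf_eq_dim_of_charZero`).

## References
* [Hartshorne1977] R. Hartshorne, *Algebraic Geometry* (1977), III Ex. 4.8 (p. 225) and III Thm. 4.5 (p. 222); II Ex. 3.22.
* [GortzWedhorn2020] U. Görtz, T. Wedhorn, *Algebraic Geometry I*, 2nd ed. (2020), Thm. 13.89 (p. 410); Prop. 13.47 (p. 493).
* [MumfordAV1970] D. Mumford, *Abelian Varieties* (1970), §13 (pp. 127–129: the cover used to bound the amplitude of the complex).
-/

set_option autoImplicit false

noncomputable section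

universe u

open CategoryTheory AlgebraicGeometry TopologicalSpace
open Literature.AlgebraicGeometry.Motives Literature.AlgebraicGeometry.Morphisms

namespace Literature.AlgebraicGeometry.ProjectiveGeometry

/-! ### §1 Integral proper `K`-schemes with an ample divisor -/

/-- **A projective variety of dimension `d` is covered by `d + 1` affine opens**: for `X` integral and proper over a field `K` with an ample
Cartier divisor, there is an affine open cover `U : Fin (schemeDim X + 1) → X.affineOpens`, `⨆ᵢ Uᵢ = X` — the preimages of the standard
charts `D₊(xᵢ)` of `ℙ^{dim X}_K` under a finite surjective `ψ : X → ℙ^{dim X}_K` (★ projective Noether normalisation over any field).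
[cite: Hartshorne1977, III Ex. 4.8 (p. 225)] [cite: GortzWedhorn2020, Thm. 13.89 (p. 410)] -/
theorem exists_affineCover_fin_schemeDim_succ {K : Type u} [Field K] {X : Scheme.{u}} [IsIntegral X] [X.Over (Spec (.of K))]
    [IsProper (X ↘ Spec (.of K))] (hamp : ∃ D : CartierDivisor X, D.IsAmple) :
    ∃ U : Fin (schemeDim X + 1) → X.affineOpens, (⨆ i, (U i).1) = ⊤ := by
  obtain ⟨D, hD⟩ := hamp
  obtain ⟨n₀, hn₀⟩ := hD.exists_finite_surjective_linEquiv (K := K)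
  obtain ⟨-, ψ, hfin, -, -, -⟩ := hn₀ 2 one_lt_two (n₀ + 1) (Nat.le_succ _) (Nat.succ_pos _)
  haveI := hfin
  exact ⟨fun i => ⟨ProjCech.cover (A := K) (r := schemeDim X) ψ i, ProjCech.isAffineOpen_cover ψ i⟩,
    ProjCech.iSup_cover_eq_top ψ⟩

/-! ### §2 Abelian varieties over any field -/

/-- **An abelian variety of dimension `g` over any field is covered by `g + 1` affine opens** (`A` is integral and proper and carries an ample
divisor, ★ `AbelianVariety.exists_isAmple_symmetric_holds`; then §1 with `schemeDim A = A.dim` by `rfl`).  This is the cover on which the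
Grothendieck ∕ Čech complex of `𝒪_A` (or of the Poincaré candidate) has amplitude `[0, g]`. [cite: MumfordAV1970, §13 (pp. 127–129)]
[cite: Hartshorne1977, III Ex. 4.8 (p. 225)] [cite: GortzWedhorn2020, Thm. 13.89 (p. 410)] -/
theorem AbelianVariety.exists_affineCover_fin_dim_succ {k : Type u} [Field k] (A : AbelianVariety k) :
    ∃ U : Fin (A.dim + 1) → A.X.left.affineOpens, (⨆ i, (U i).1) = ⊤ := by
  haveI : IsProper (A.X.left ↘ Spec (.of k)) := A.isProper
  obtain ⟨D, hD, -⟩ := (AbelianVariety.exists_isAmple_symmetric_holds (A := A))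
  exact exists_affineCover_fin_schemeDim_succ (K := k) ⟨D, hD⟩

/-- The same, UNBUNDLED (`U : Fin (A.dim + 1) → A.X.left.Opens`, each `Uᵢ` affine, `iSup U = ⊤`) — the binder shape of ★
`AbelianVarieties.finrank_cechH1_structureSheaf_eq_dim_of_charZero` and of ★ `Modules.cechComplex` consumers. [cite: MumfordAV1970, §13 (pp. 127–129)]
[cite: Hartshorne1977, III Ex. 4.8 (p. 225)] -/
theorem AbelianVariety.exists_affineCover_fin_dim_succ' {k : Type u} [Field k] (A : AbelianVariety k) :
    ∃ U : Fin (A.dim + 1) → A.X.left.Opens, (∀ i, IsAffineOpen (U i)) ∧ iSup U = ⊤ := by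
  obtain ⟨U, hU⟩ := AbelianVariety.exists_affineCover_fin_dim_succ A
  exact ⟨fun i => (U i).1, fun i => (U i).2, hU⟩

end Literature.AlgebraicGeometry.ProjectiveGeometry

end
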